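import Summits.QuantumFields.BalabanUV.Beta.D1BFx.PairingWardSplit
import Summits.QuantumFields.BalabanUV.Beta.D1BFx.NeedleDipDipRow
import Summits.QuantumFields.BalabanUV.Beta.D1BFx.DiagonalLegGrade

/-!
# `BalabanUV.Beta.D1BFx.NeedleDipWardLetter` — road «BF-x» for binder row D1, slot (K), END row `hGrp gN`, «h𝔅₂₂» PART 2: THE `(δρ, δρ′)`
# PAIRING LETTER OF THE `dip ⊗ dip` CELL IS A THEOREM — `|⟨∇δρ_{u,κ}, Ga∇δρ_{v,κ′}⟩| ≤ K𝔅∕n⁴∕nrm(u−v)² + K𝔅∕n⁶`, ONE n-free `K𝔅 ≥ 0`, for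
# every `n ≥ 1` and all bond pairs, UNCONDITIONALLY (`0 < a` only) — hence «GN-33∕KK» closes modulo [B5, Prop. 1.2] ∧ [B5, (1.126)–(1.127)] BY NAME

HONEST DEPENDENCY (cell records, verbatim): «continuum YM on T⁴ ⇐ BetaPertH ∧ nine spine estimates (0/9 proved); BetaPertH ⇐ (D1) ∧ (D4) ∧
CAP+tail; G-an2-4 gates asym, D1 and NE2/3/4.»  HONEST FRAMING (cell contract, verbatim): «discharging `BetaPertH` makes Bałaban's UV stability
UNCONDITIONAL — a real constructive-QFT result; it is NOT the continuum limit and NOT the Clay problem.»  THIS MODULE DISCHARGES NOTHING of the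
wall: [folklore] lattice bookkeeping BY NAME over PART 1 (`PairingWardSplit.abs_pairing_grad_applyK_grad_le`), the UNCONDITIONAL flat mixed
second-difference letters of the gluon leg's remainder `Ga − δ·G₀` (`DiagonalLegGrade.abs_Kinf_diag_flat_sub_sub_le`,
`OffDiagonalLegGrade.abs_Kinf_offDiag_sub_sub_le`), its temperedness `GluonLeg.abs_Ga_le`, the dipole letter of `NeedleDipDipLetters.exists_functionLetters`
(gan24-leaf-05's `RColumnProfileDipole`) and leaf-04-g9's HLS kit (`LatticeHLS.sum_inv_nrm_pow_mul_le`, `LatticeHLSRadial.sum_exp_div_nrm_pow_le`);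
the corollary feeds the letter into leaf-04-g9's `NeedleDipDipRow.exists_dipDip_row_le`.  No `def`, no `def … : Prop`, nothing cited, 0 sorry.
Root-level binders hW ∕ hR-sockets ∕ hSX-socket ∕ D1Tel ∕ D1Rep — 0 discharged; (K) NOT closed; NOT D1, NOT `BetaPertH`, NOT continuum, NOT Clay.

ABSOLUTE RULE (cell charter, verbatim): «No internally-minted statement may enter as a cited fact. Every hypothesis is either kernel-proved in
this package or a verbatim quotation of a PUBLISHED theorem with page reference. The manuscript(s) under audit are NOT citable for their own
disputed steps — they are the thing under adjudication; programme-internal (2001/route/tribunal) claims are never citable.»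

WHY (leaf-04-g9 Q-d1leaf04g9-KK-1; owner d1-p2-g11 RULINGS ρ-g11-2∕ρ-g11-3 «leaf-04-g10 → `h𝔅₂₂`»; the owner's «GN-WIRE» displays `h𝔅₂₂` in the
shape of `NeedleDipDipRow`).  THE COUNT (an3-g59 §3′ (4) R2⊗R2, the `(δρ,δρ′)` type): free part `Σ'_x δρ_u(x)·δρ_v(x) ≤ (kR∕n²)²·Σ_x nrm(x−u)⁻³nrm(x−v)⁻³
≤ (kR∕n²)²·C₄∕nrm(u−v)²` (two dipoles at ONE site, `(3,3) ↦ 2`, log-free); remainder `16·(D∕n⁴)·(Σ'|δρ_u|)(Σ'|δρ_v|) ≤ 16·D·(kR·(217 + 432∕ε₀))²∕n⁶`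
(`Σ'|δρ| ≤ kR∕n²·𝕂₃(ε₀∕n) ≤ kR·(217+432∕ε₀)∕n`).  `K𝔅 := kR²·C₄ + 16·D·kR²·(217+432∕ε₀)²`, `D := (woodburyD2c 0 + ellD2 4 a) + ellD2 4 a`.

CONTENT (`a > 0`).
* §1 [folklore] **`abs_mixedDiff_Ga_sub_free_le`** — the flat letter of the remainder in PART 1's shape:
  `|D²Ga(x,y)_{ab} − [a=b]·(2G₀(y−x) − G₀(y−x−e_a) − G₀(y−x+e_a))| ≤ D∕n⁴`, `D = woodburyD2c 0 + 2·ellD2 4 a`.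
* §2 [folklore] `summable_abs_and_tsum_le_of_dipole` (ℓ¹ norm of a damped degree-3 profile at scale `n`), `tsum_abs_mul_le_of_dipoles` (the `(3,3) ↦ 2` site sum).
* §3 [folklore] **`exists_wardPairing_le (ha : 0 < a) : ∃ K𝔅 ≥ 0, ∀ n [NeZero n] u v κ κ′, |⟨∇δρ_{u,κ}, Ga∇δρ_{v,κ′}⟩| ≤ K𝔅∕n⁴∕nrm(u−v)² + K𝔅∕n⁶`**
  — the DISPLAYED hypothesis `h𝔅` of `NeedleDipDipRow.exists_dipDip_row_le`, verbatim.
* §4 [folklore] **`exists_dipDip_row_le_of_ward`** — «GN-33∕KK» with `h𝔅₂₂` DISCHARGED: `hdd` of `GluonNeedleGlue.h₃_of_cells` modulo `h12`∕`h126`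
  and the ray pin `cK n = cgh·n²` only.
Unit `b2b-balaban-beta-d1-formalise-leaf-04` (gen 10); `LEAVES-BFx.md` row (N) «h𝔅₂₂» PART 2.
-/

noncomputable section

namespace Summit.QuantumFields.BalabanUV.Beta.D1BFx.NeedleDipWardLetter

open Finset
open scoped BigOperators
open Literature.MathematicalPhysics.QuantumFieldTheory.Balaban1983to89
open Literature.MathematicalPhysics.QuantumFieldTheory.Balaban1983to89.Beta
open ExpKernelCalculus (Site MKer)
open AffineAveraging (unitVec)
open VectorTailsLoc (fam kfam)
open PoissonInterior (nrm nrm_pos one_le_nrm nrm_neg supNorm supNorm_neg G₀)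
open LongitudinalWindow (ellD2)
open WoodburyCovariant (woodburyD2c)
open VectorLegVolumeAdapter (woodburyD2c_zero_nonneg)
open Summit.QuantumFields.BalabanUV.Beta.D1BFx.RProjector (Pgt)
open Summit.QuantumFields.BalabanUV.Beta.D1BFx.GhostLeg (Ggh)
open Summit.QuantumFields.BalabanUV.Beta.D1BFx.RProjectorJet (RG)
open Summit.QuantumFields.BalabanUV.Beta.D1BFx.GluonLeg (Ga Ga_apply abs_Ga_le)
open Summit.QuantumFields.BalabanUV.Beta.D1BFx.FrozenLegTails (nOf MOf hn1)
open Summit.QuantumFields.BalabanUV.Beta.D1BFx.GluonNeedleSplit (dipPiece)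
open Summit.QuantumFields.BalabanUV.Beta.D1BFx.GluonNeedleGlue (cellSum)
open Summit.QuantumFields.BalabanUV.Beta.D1BFx.RankOneBubble (applyK pairing)
open Summit.QuantumFields.BalabanUV.Beta.D1BFx.RankOneBubbleJets (grad)
open Summit.QuantumFields.BalabanUV.Beta.D1BFx.LatticeHLSRadial (sum_exp_div_nrm_pow_le)
open Summit.QuantumFields.BalabanUV.Beta.D1BFx.LatticeHLS (sum_inv_nrm_pow_mul_le)
open Summit.QuantumFields.BalabanUV.Beta.D1BFx.LatticeHLSProfiles (summable_and_abs_tsum_le_of_abs_sum_le)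
open Summit.QuantumFields.BalabanUV.Beta.D1BFx.OffDiagonalLegGrade (ellD2_nonneg sq_mul_div_pow_add_two abs_Kinf_offDiag_sub_sub_le)
open Summit.QuantumFields.BalabanUV.Beta.D1BFx.DiagonalLegGrade (abs_Kinf_diag_flat_sub_sub_le)
open Summit.QuantumFields.BalabanUV.Beta.D1BFx.NeedleDipDipLetters (exists_functionLetters)
open Summit.QuantumFields.BalabanUV.Beta.D1BFx.NeedleDipDipRow (exists_dipDip_row_le)
open Summit.QuantumFields.BalabanUV.Beta.D1BFx.PairingWardSplit (abs_pairing_grad_applyK_grad_le)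

/-! ## §1 The flat letter of the remainder `Ga − δ·G₀` in PART 1's shape -/

/-- [folklore] **THE MIXED SECOND DIFFERENCE OF `Ga` IS THE FREE ONE UP TO A FLAT `n⁻⁴`** (UNCONDITIONAL: `n ≥ 1`, `a > 0`):
`|D²Ga(x,y)_{ab} − [a=b]·(2G₀(y−x) − G₀(y−x−e_a) − G₀(y−x+e_a))| ≤ (woodburyD2c 0 + 2·ellD2 4 a)∕n⁴` — on the component diagonal the diagonal flat
letter `DiagonalLegGrade.abs_Kinf_diag_flat_sub_sub_le` at the base points `(x − e_a, y − e_a)`, off it `OffDiagonalLegGrade.abs_Kinf_offDiag_sub_sub_le`. -/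
theorem abs_mixedDiff_Ga_sub_free_le (n : ℕ) [NeZero n] {a : ℝ} (ha : 0 < a) (x y : Site 4) (b c : Fin 4) :
    |((Ga n a (x - unitVec b) (y - unitVec c) b c - Ga n a x (y - unitVec c) b c) - (Ga n a (x - unitVec b) y b c - Ga n a x y b c))
        - (if b = c then 2 * G₀ (y - x) - G₀ (y - x - unitVec b) - G₀ (y - x + unitVec b) else 0)|
      ≤ (woodburyD2c 0 + ellD2 4 a + ellD2 4 a) / (n : ℝ) ^ 4 := by
  have hn : 1 ≤ n := NeZero.one_le
  have hD₁ : 0 ≤ woodburyD2c 0 := woodburyD2c_zero_nonneg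
  have hD₂ : 0 ≤ ellD2 4 a := ellD2_nonneg ha
  have hn4 : (0 : ℝ) < (n : ℝ) ^ 4 := by positivity
  by_cases hbc : b = c
  · subst hbc
    rw [if_pos rfl]
    have h := abs_Kinf_diag_flat_sub_sub_le n hn ha b b b (x - unitVec b) (y - unitVec b)
    have hu : (Pi.single b 1 : Fin 4 → ℤ) = unitVec b := rfl
    rw [hu] at h
    simp only [sub_add_cancel, ← Ga_apply] at h
    rw [show y - (x - unitVec b) = y - x + unitVec b from by abel, show y - unitVec b - x = y - x - unitVec b from by abel,
      show y - unitVec b - (x - unitVec b) = y - x from by abel] at h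
    have e : ((Ga n a (x - unitVec b) (y - unitVec b) b b - Ga n a x (y - unitVec b) b b) - (Ga n a (x - unitVec b) y b b - Ga n a x y b b))
        - (2 * G₀ (y - x) - G₀ (y - x - unitVec b) - G₀ (y - x + unitVec b))
        = ((Ga n a x y b b - G₀ (y - x)) - (Ga n a (x - unitVec b) y b b - G₀ (y - x + unitVec b)))
          - ((Ga n a x (y - unitVec b) b b - G₀ (y - x - unitVec b)) - (Ga n a (x - unitVec b) (y - unitVec b) b b - G₀ (y - x))) := by ring
    rw [e]
    refine h.trans (div_le_div_of_nonneg_right (by linarith) hn4.le)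
  · rw [if_neg hbc, sub_zero]
    have h := abs_Kinf_offDiag_sub_sub_le n hn ha (by norm_num) hbc b c (x - unitVec b) (y - unitVec c)
    have hu : (Pi.single b 1 : Fin 4 → ℤ) = unitVec b := rfl
    have hu' : (Pi.single c 1 : Fin 4 → ℤ) = unitVec c := rfl
    rw [hu, hu', sq_mul_div_pow_add_two] at h
    simp only [sub_add_cancel, ← Ga_apply] at h
    have e : (Ga n a (x - unitVec b) (y - unitVec c) b c - Ga n a x (y - unitVec c) b c) - (Ga n a (x - unitVec b) y b c - Ga n a x y b c)
        = (Ga n a x y b c - Ga n a (x - unitVec b) y b c) - (Ga n a x (y - unitVec c) b c - Ga n a (x - unitVec b) (y - unitVec c) b c) := by ring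
    rw [e]
    refine h.trans (div_le_div_of_nonneg_right (by linarith) hn4.le)

/-! ## §2 The ℓ¹ norm of a damped dipole profile and the `(3,3) ↦ 2` site sum -/

/-- [folklore] **ℓ¹ NORM OF A DAMPED DEGREE-3 PROFILE AT SCALE `n`** (`0 < ε₀`, `n ≥ 1`, `K ≥ 0`): `|f x| ≤ K·e^{−(ε₀∕n)‖x−u‖}∕nrm(x−u)³` for all `x` ⇒
`|f|` is summable and `Σ'|f| ≤ K·(217 + 432∕ε₀)·n` (`sum_exp_div_nrm_pow_le` at `p = 3`: `𝕂₃(ε₀∕n) = 1 + 216·(1 + 2n∕ε₀)`). -/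
theorem summable_abs_and_tsum_le_of_dipole {n : ℕ} (hn : 1 ≤ n) {ε₀ K : ℝ} (hε₀ : 0 < ε₀) (hK : 0 ≤ K) {f : Site 4 → ℝ} (u : Site 4)
    (hf : ∀ x : Site 4, |f x| ≤ K * Real.exp (-(ε₀ / n) * supNorm (x - u)) / nrm (x - u) ^ 3) :
    Summable (fun x => |f x|) ∧ ∑' x, |f x| ≤ K * (217 + 432 / ε₀) * n := by
  have hn0 : (0 : ℝ) < n := by exact_mod_cast hn
  have hnR : (1 : ℝ) ≤ n := by exact_mod_cast hn
  have hεn : 0 < ε₀ / n := div_pos hε₀ hn0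
  have hK3 : (1 + 2 * (4 : ℕ) * 3 ^ (4 - 1) * (((4 - 1 - 3).factorial : ℝ) * (2 / (ε₀ / n)) ^ (4 - 1 - 3) * (1 + 2 / (ε₀ / n))))
      ≤ (217 + 432 / ε₀) * n := by
    have e1 : (1 + 2 * (4 : ℕ) * 3 ^ (4 - 1) * (((4 - 1 - 3).factorial : ℝ) * (2 / (ε₀ / n)) ^ (4 - 1 - 3) * (1 + 2 / (ε₀ / n))))
        = 217 + 432 / ε₀ * n := by
      norm_num [Nat.factorial]
      field_simp
      ring
    rw [e1]
    have h432 : (0 : ℝ) ≤ 432 / ε₀ := by positivity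
    nlinarith
  have hS : ∀ S : Finset (Site 4), ∑ x ∈ S, |(fun x => |f x|) x| ≤ K * (217 + 432 / ε₀) * n := by
    intro S
    calc ∑ x ∈ S, |(fun x => |f x|) x| = ∑ x ∈ S, |f x| := Finset.sum_congr rfl fun x _ => abs_abs _
      _ ≤ ∑ x ∈ S, K * (Real.exp (-(ε₀ / n) * supNorm (x - u)) / nrm (x - u) ^ 3) :=
          Finset.sum_le_sum fun x _ => (hf x).trans (le_of_eq (by ring))
      _ = K * ∑ x ∈ S, Real.exp (-(ε₀ / n) * supNorm (x - u)) / nrm (x - u) ^ 3 := by rw [Finset.mul_sum]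
      _ ≤ K * ((217 + 432 / ε₀) * n) :=
          mul_le_mul_of_nonneg_left ((sum_exp_div_nrm_pow_le (d := 4) (by norm_num) hεn (p := 3) (by norm_num) S u).trans hK3) hK
      _ = _ := by ring
  have h := summable_and_abs_tsum_le_of_abs_sum_le hS
  exact ⟨h.1, (le_abs_self _).trans h.2⟩

/-- [folklore] **TWO DIPOLES AT ONE SITE, `(3,3) ↦ 2`** (`K, K′ ≥ 0`): `|f x| ≤ K∕nrm(x−u)³`, `|g x| ≤ K′∕nrm(x−v)³` ⇒
`Σ'_x |f x·g x| ≤ K·K′·C₄∕nrm(u−v)²`, `C₄ = 4·2⁷·9³` (`LatticeHLS.sum_inv_nrm_pow_mul_le`; log-free since `3 < 4`). -/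
theorem tsum_abs_mul_le_of_dipoles {K K' : ℝ} (hK : 0 ≤ K) (hK' : 0 ≤ K') {f g : Site 4 → ℝ} (u v : Site 4)
    (hf : ∀ x : Site 4, |f x| ≤ K / nrm (x - u) ^ 3) (hg : ∀ x : Site 4, |g x| ≤ K' / nrm (x - v) ^ 3) :
    ∑' x, |f x * g x| ≤ K * K' * ((4 : ℕ) * 2 ^ (4 + 3) * 9 ^ (4 - 1)) / nrm (u - v) ^ 2 := by
  have hS : ∀ S : Finset (Site 4), ∑ x ∈ S, |(fun x => |f x * g x|) x| ≤ K * K' * ((4 : ℕ) * 2 ^ (4 + 3) * 9 ^ (4 - 1)) / nrm (u - v) ^ 2 := by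
    intro S
    have hpt : ∀ x ∈ S, |(fun x => |f x * g x|) x| ≤ K * K' * (1 / (nrm (x - u) ^ 3 * nrm (x - v) ^ 3)) := by
      intro x _
      have h1 := nrm_pos (d := 4) (x - u); have h2 := nrm_pos (d := 4) (x - v)
      rw [abs_abs, abs_mul]
      calc |f x| * |g x| ≤ (K / nrm (x - u) ^ 3) * (K' / nrm (x - v) ^ 3) := mul_le_mul (hf x) (hg x) (abs_nonneg _) (by positivity)
        _ = K * K' * (1 / (nrm (x - u) ^ 3 * nrm (x - v) ^ 3)) := by field_simp
    have h := sum_inv_nrm_pow_mul_le (d := 4) (by norm_num) (a := 3) (b := 3) (by norm_num) (by norm_num) (by norm_num) S u v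
    rw [show 3 + 3 - 4 = 2 from rfl] at h
    calc ∑ x ∈ S, |(fun x => |f x * g x|) x| ≤ ∑ x ∈ S, K * K' * (1 / (nrm (x - u) ^ 3 * nrm (x - v) ^ 3)) := Finset.sum_le_sum hpt
      _ = K * K' * ∑ x ∈ S, 1 / (nrm (x - u) ^ 3 * nrm (x - v) ^ 3) := by rw [Finset.mul_sum]
      _ ≤ K * K' * (((4 : ℕ) : ℝ) * 2 ^ (4 + 3) * 9 ^ (4 - 1) / nrm (u - v) ^ 2) := mul_le_mul_of_nonneg_left h (by positivity)
      _ = _ := by ring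
  exact (le_abs_self _).trans (summable_and_abs_tsum_le_of_abs_sum_le hS).2

/-! ## §3 The letter -/

/-- [folklore] **«h𝔅₂₂» — THE `(δρ, δρ′)` PAIRING LETTER OF THE `dip ⊗ dip` CELL, UNCONDITIONAL** (`0 < a`): `∃ K𝔅 ≥ 0`, n-free, with
`|⟨∇δρ_{u,κ}, Ga∇δρ_{v,κ′}⟩| ≤ K𝔅∕n⁴∕nrm(u−v)² + K𝔅∕n⁶` for every `n ≥ 1` and all bond pairs — the displayed hypothesis `h𝔅` of
`NeedleDipDipRow.exists_dipDip_row_le` VERBATIM.  Free leg: Ward collapse to two dipoles at one site (`(3,3) ↦ 2`); remainder: flat mixed second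
difference `× (Σ'|δρ|)² ≍ n⁻⁴·n⁻²` (PART 1 `PairingWardSplit.abs_pairing_grad_applyK_grad_le`). -/
theorem exists_wardPairing_le {a : ℝ} (ha : 0 < a) :
    ∃ K𝔅 : ℝ, 0 ≤ K𝔅 ∧ ∀ (n : ℕ) [NeZero n] (u v : Site 4) (κ κ' : Fin 4),
      |pairing (grad (fun x => RG (Ggh n a) (Pgt n a) x (u + unitVec κ) () () - RG (Ggh n a) (Pgt n a) x u () ()))
          (applyK (Ga n a) (grad (fun x => RG (Ggh n a) (Pgt n a) x (v + unitVec κ') () () - RG (Ggh n a) (Pgt n a) x v () ())))|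
        ≤ K𝔅 / (n : ℝ) ^ 4 / nrm (u - v) ^ 2 + K𝔅 / (n : ℝ) ^ 6 := by
  obtain ⟨ε₂, cF, kR, hε₂, hε₂1, hcF, hkR, hfun⟩ := exists_functionLetters a ha
  have hD₁ : 0 ≤ woodburyD2c 0 := woodburyD2c_zero_nonneg
  have hD₂ : 0 ≤ ellD2 4 a := ellD2_nonneg ha
  obtain ⟨K𝔅, hK𝔅⟩ : ∃ K𝔅 : ℝ, K𝔅 = kR * kR * ((4 : ℕ) * 2 ^ (4 + 3) * 9 ^ (4 - 1))
      + 16 * (woodburyD2c 0 + ellD2 4 a + ellD2 4 a) * (kR * (217 + 432 / ε₂)) * (kR * (217 + 432 / ε₂)) := ⟨_, rfl⟩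
  refine ⟨K𝔅, by rw [hK𝔅]; positivity, fun n _ u v κ κ' => ?_⟩
  have hn1 : 1 ≤ n := NeZero.one_le
  have hn : (0 : ℝ) < n := by exact_mod_cast Nat.pos_of_ne_zero (NeZero.ne n)
  have hn0 : (n : ℝ) ≠ 0 := hn.ne'
  have hfn := hfun ε₂ hε₂ le_rfl n
  -- the two dipole letters
  have hf := (hfn u κ).2.2.2
  have hg := (hfn v κ').2.2.2
  have hkR2 : 0 ≤ kR / (n : ℝ) ^ 2 := by positivity
  -- ℓ¹ norms and the one-site sum
  obtain ⟨hfs, hfT⟩ := summable_abs_and_tsum_le_of_dipole hn1 hε₂ hkR2 u hf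
  obtain ⟨hgs, hgT⟩ := summable_abs_and_tsum_le_of_dipole hn1 hε₂ hkR2 v hg
  have lE1 : ∀ z : Site 4, Real.exp (-(ε₂ / n) * supNorm z) ≤ 1 := fun z => by
    rw [Real.exp_le_one_iff, neg_mul]; exact neg_nonpos.mpr (mul_nonneg (div_pos hε₂ hn).le (Nat.cast_nonneg _))
  have hf' : ∀ x : Site 4, |RG (Ggh n a) (Pgt n a) x (u + unitVec κ) () () - RG (Ggh n a) (Pgt n a) x u () ()| ≤ kR / (n : ℝ) ^ 2 / nrm (x - u) ^ 3 :=
    fun x => (hf x).trans (div_le_div_of_nonneg_right (mul_le_of_le_one_right hkR2 (lE1 _)) (pow_pos (nrm_pos _) 3).le)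
  have hg' : ∀ x : Site 4, |RG (Ggh n a) (Pgt n a) x (v + unitVec κ') () () - RG (Ggh n a) (Pgt n a) x v () ()| ≤ kR / (n : ℝ) ^ 2 / nrm (x - v) ^ 3 :=
    fun x => (hg x).trans (div_le_div_of_nonneg_right (mul_le_of_le_one_right hkR2 (lE1 _)) (pow_pos (nrm_pos _) 3).le)
  have hfg := tsum_abs_mul_le_of_dipoles hkR2 hkR2 u v hf' hg'
  -- PART 1
  have h := abs_pairing_grad_applyK_grad_le (fun x y c b => abs_Ga_le n a hn1 ha x y c b) hfs hgs (abs_mixedDiff_Ga_sub_free_le n ha)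
  refine h.trans ?_
  have hnuv := nrm_pos (d := 4) (u - v)
  -- the two n-free constants inside `K𝔅`
  have hK₁ : kR * kR * ((4 : ℕ) * 2 ^ (4 + 3) * 9 ^ (4 - 1)) ≤ K𝔅 := by rw [hK𝔅]; exact le_add_of_nonneg_right (by positivity)
  have hK₂ : 16 * (woodburyD2c 0 + ellD2 4 a + ellD2 4 a) * (kR * (217 + 432 / ε₂)) * (kR * (217 + 432 / ε₂)) ≤ K𝔅 := by
    rw [hK𝔅]; exact le_add_of_nonneg_left (by positivity)
  -- term 1: the free part
  have t1 : ∑' x, |(RG (Ggh n a) (Pgt n a) x (u + unitVec κ) () () - RG (Ggh n a) (Pgt n a) x u () ())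
        * (RG (Ggh n a) (Pgt n a) x (v + unitVec κ') () () - RG (Ggh n a) (Pgt n a) x v () ())| ≤ K𝔅 / (n : ℝ) ^ 4 / nrm (u - v) ^ 2 := by
    refine hfg.trans ?_
    have e : kR / (n : ℝ) ^ 2 * (kR / (n : ℝ) ^ 2) * ((4 : ℕ) * 2 ^ (4 + 3) * 9 ^ (4 - 1)) / nrm (u - v) ^ 2
        = kR * kR * ((4 : ℕ) * 2 ^ (4 + 3) * 9 ^ (4 - 1)) / (n : ℝ) ^ 4 / nrm (u - v) ^ 2 := by
      field_simp
    rw [e]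
    exact div_le_div_of_nonneg_right (div_le_div_of_nonneg_right hK₁ (by positivity)) (by positivity)
  -- term 2: the remainder
  have hTg0 : 0 ≤ ∑' x, |RG (Ggh n a) (Pgt n a) x (v + unitVec κ') () () - RG (Ggh n a) (Pgt n a) x v () ()| :=
    tsum_nonneg fun _ => abs_nonneg _
  have t2 : 16 * ((woodburyD2c 0 + ellD2 4 a + ellD2 4 a) / (n : ℝ) ^ 4)
        * (∑' x, |RG (Ggh n a) (Pgt n a) x (u + unitVec κ) () () - RG (Ggh n a) (Pgt n a) x u () ()|)
        * (∑' x, |RG (Ggh n a) (Pgt n a) x (v + unitVec κ') () () - RG (Ggh n a) (Pgt n a) x v () ()|) ≤ K𝔅 / (n : ℝ) ^ 6 := by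
    have s1 : 16 * ((woodburyD2c 0 + ellD2 4 a + ellD2 4 a) / (n : ℝ) ^ 4)
        * (∑' x, |RG (Ggh n a) (Pgt n a) x (u + unitVec κ) () () - RG (Ggh n a) (Pgt n a) x u () ()|)
        ≤ 16 * ((woodburyD2c 0 + ellD2 4 a + ellD2 4 a) / (n : ℝ) ^ 4) * (kR / (n : ℝ) ^ 2 * (217 + 432 / ε₂) * n) :=
      mul_le_mul_of_nonneg_left hfT (by positivity)
    have s2 := mul_le_mul s1 hgT hTg0 (by positivity)
    refine s2.trans ?_
    have e : 16 * ((woodburyD2c 0 + ellD2 4 a + ellD2 4 a) / (n : ℝ) ^ 4) * (kR / (n : ℝ) ^ 2 * (217 + 432 / ε₂) * n)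
        * (kR / (n : ℝ) ^ 2 * (217 + 432 / ε₂) * n)
        = 16 * (woodburyD2c 0 + ellD2 4 a + ellD2 4 a) * (kR * (217 + 432 / ε₂)) * (kR * (217 + 432 / ε₂)) / (n : ℝ) ^ 6 := by
      field_simp
    rw [e]
    exact div_le_div_of_nonneg_right hK₂ (by positivity)
  exact add_le_add t1 t2

/-! ## §4 «GN-33 ∕ KK» with the letter discharged -/

/-- [folklore] **«GN-33 ∕ KK» WITH `h𝔅₂₂` DISCHARGED**: the `dipPiece ⊗ dipPiece` cell of T₃ with its weight `cK(n)² = cgh²·n⁴` is n-uniform,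
modulo [B5, Prop. 1.2] ∧ [B5, (1.126)–(1.127)] BY NAME and the ray pin `cK n = cgh·n²` ONLY — `hdd` of `GluonNeedleGlue.h₃_of_cells`
(leaf-04-g9's `NeedleDipDipRow.exists_dipDip_row_le` fed with §3). -/
theorem exists_dipDip_row_le_of_ward {a : ℝ} (ha : 0 < a) (h12 : B5.Prop12Printed (fam nOf hn1 MOf a ha))
    (h126 : B5.Kernel126_127Printed (kfam nOf MOf)) {cK : ℕ → ℝ} {cgh : ℝ} (hcK : ∀ n : ℕ, cK n = cgh * (n : ℝ) ^ 2) (μ ν : Fin 4) :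
    ∃ Cdd : ℝ, 0 ≤ Cdd ∧ ∀ n : ℕ, 2 ≤ n → ∀ [NeZero n], |cK n * cK n * cellSum n a (dipPiece n a) (dipPiece n a) μ ν| ≤ Cdd := by
  obtain ⟨K𝔅, hK𝔅, h𝔅⟩ := exists_wardPairing_le ha
  exact exists_dipDip_row_le ha h12 h126 hcK hK𝔅 h𝔅 μ ν

end Summit.QuantumFields.BalabanUV.Beta.D1BFx.NeedleDipWardLetter

end
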